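import Literature.AnabelianGeometry.SemiGraphs.TemperedTopCyclicLocalTransportSameImage
import HarnessLib

/-!
# [SemiAnbd] Thm 3.7 (iii) / Cor 3.9 (R3c): the image-preserving one-level local transport of fixed
# branches for ARBITRARY edge groups, under SATURATION of the hosted piece (proof-only)

Mochizuki, *Semi-graphs of anabelioids*, Publ. RIMS **42** (2006), §2 Remark 2.2.1 p. 24 ("the image
of each `Π_b` in `Π_𝒢` is equal to the stabilizer of a compatible system of edges") and §3 Theorem 3.7 (iii),
proof p. 41, third paragraph, with the author's *Comments* (2020) (6)(b); Corollary 3.9, proof p. 43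
l. 13 (the cell's step (R3c), FACT-LIST rows F-2772 `EdgeLikeCentralizerAt` / F-2773 `EdgeLikeCentralizer`)
[cite: MochizukiSemiAnbd2006, Thm 3.7(iii) p.41].

PROOF-ONLY (cell abc-iut, block F, seat abc-iut-f-176 gen 5; the CLASS-FREE form of abc-iut-f-172 gen 7's
brick (A⁺) `GaloisLevelData.exists_fixed_branch_transport_sameImage` — the ONE place where the class
hypothesis «all edge groups topologically cyclic» enters the chain p491241 → p491520 → p493068 → p493572
closing (R3c) on that class; no definition, no named fact).  The cyclic hypothesis is used only to conclude
that two conjugates `σ_a⁻¹ M σ_a`, `σ⁻¹ M σ` of the image `M` of `C`, both lying in the one finite image `Z`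
of `Π_{b₀}` in `Gal(𝒢_{∞,n}/𝒢)`, COINCIDE (a cyclic group has one subgroup of each order).  Here the same
conclusion — indeed `σ_a⁻¹ M σ_a ≤ σ⁻¹ M σ`, which is all the transport needs — is obtained for an ARBITRARY
edge group `Π_{e(b₀)}` from two facts: (i) the adjusted coordinate `σ_a` of (A⁺) has the same image as `σ`
in `Gal(𝒢_{∞,j}/𝒢)`, so the two conjugates have the same image at level `j`; (ii) SATURATION: `σ⁻¹ M σ`
contains the level-`j` kernel of `Z` (equivalently: every element of the stabiliser of the fixed branch
`β` that dies at level `j` lies in the image of `C`).  Then `σ_a⁻¹ M σ_a ≤ (σ⁻¹ M σ)·(Z ∩ ker) = σ⁻¹ M σ`.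
* `PointSeq.forall_exists_branchSubgroup_ρ_apply_eq_transport_of_saturated` — point form;
* `GaloisLevelData.exists_fixed_branch_transport_sameImage_of_saturated` — tree form, same signature as
  (A⁺) with the generator `t₀` of `Π_{e(b₀)}` replaced by the saturation hypothesis at `β`:
  `∀ q ∈ Gal(𝒢_{∞,n}/𝒢)`, `q ↦ 1` at level `j` and `q` fixes the edge of `β` ⇒ `q ∈ ρ_n(C)`.
Size bookkeeping (why this is the natural hypothesis): `|ρ_n(C) ∩ ker| = |ρ_n(C)|/|ρ_j(C)|` and
`|Stab(β) ∩ ker| = |Stab_n(β)|/|Stab_j(β̄)|`, the first group lies in the second, so saturation is the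
equality «the host grows exactly as fast as `C` between levels `j` and `n`»; it holds e.g. when `C` is the
image of an open subgroup `U ⊇ Π_e ∩ ker ρ_j` of the edge group hosting `β` in its standard position, and it
is incomparable with topological cyclicity.

Honest framing: one sufficient condition at one branch; the ∀-closures F-2773 / F-1732 are NOT claimed;
nothing here bears on [IUTchIII] Cor. 3.12; typed ≠ proved elsewhere.
-/

namespace Literature.AnabelianGeometry.SemiGraphs

namespace ProfiniteSemiGraph

namespace GaloisLevelData

open CategoryTheory Topology

open Literature.AlgebraicGeometry.Frobenioids.QuasiTemperoid.BTempConnected (ρ_one_apply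
  ρ_mul_apply ρ_inv_apply)

universe u

variable {𝒢 : ProfiniteSemiGraph.{u}} {D : GaloisLevelData 𝒢} {h𝒢 : 𝒢.IsCountable}

namespace PointSeq

variable {w : 𝒢.graph.Vertex} (P : D.PointSeq h𝒢 w)

/-- **Local transport, point form, ARBITRARY edge group, under saturation.**  Let `M ≤ Gal(𝒢_{∞,n}/𝒢)`
fix the branches `brOf b₀ (σ_a·pt)`, `brOf b₀ (σ·pt)` and `brOf b₁ (σ'·pt)` (each in the sense
`∃ k ∈ Π_b, k · q(y) = y`), let `σ_a` and `σ` have the same image in `Gal(𝒢_{∞,j}/𝒢)`, and suppose the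
SATURATION: every element of the image `Z` of `Π_{b₀}` dying at level `j` lies, after conjugation by `σ`,
in `M`.  Then `M` fixes `brOf b₁ ((σ_a σ⁻¹ σ')·pt)`.  (Proof: `σ_a⁻¹ M σ_a` and `σ⁻¹ M σ` lie in `Z` with the
same level-`j` image, so the former lies in `(σ⁻¹ M σ)·(Z ∩ ker) = σ⁻¹ M σ`; hence for `q ∈ M` there is
`q' ∈ M` with `σ_a⁻¹ q σ_a = σ⁻¹ q' σ`.) [cite: MochizukiSemiAnbd2006, Thm 3.7(iii) p.41] -/
theorem forall_exists_branchSubgroup_ρ_apply_eq_transport_of_saturated (n : ℕ) {j : ℕ} (hjn : j ≤ n)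
    {b₀ b₁ : 𝒢.graph.Branch} (hb₀ : 𝒢.graph.abuts b₀ = some w) (hb₁ : 𝒢.graph.abuts b₁ = some w)
    (M : Subgroup (D.Gal h𝒢 n)) (σa σ σ' : D.Gal h𝒢 n)
    (hlev : D.mapLE h𝒢 hjn σa = D.mapLE h𝒢 hjn σ)
    (hsat : ∀ z ∈ (𝒢.branchSubgroup b₀ w hb₀).map ((D.proj h𝒢 n).comp P.decompHom),
      D.mapLE h𝒢 hjn z = 1 → σ * z * σ⁻¹ ∈ M)
    (hα : ∀ q ∈ M, ∃ k ∈ 𝒢.branchSubgroup b₀ w hb₀, ((D.cover h𝒢 n).SV w).obj.ρ k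
        ((q.hom.fV w).hom.hom ((σa.hom.fV w).hom.hom (P.pt n))) = (σa.hom.fV w).hom.hom (P.pt n))
    (hβ : ∀ q ∈ M, ∃ k ∈ 𝒢.branchSubgroup b₀ w hb₀, ((D.cover h𝒢 n).SV w).obj.ρ k
        ((q.hom.fV w).hom.hom ((σ.hom.fV w).hom.hom (P.pt n))) = (σ.hom.fV w).hom.hom (P.pt n))
    (hβ' : ∀ q ∈ M, ∃ k ∈ 𝒢.branchSubgroup b₁ w hb₁, ((D.cover h𝒢 n).SV w).obj.ρ k
        ((q.hom.fV w).hom.hom ((σ'.hom.fV w).hom.hom (P.pt n))) = (σ'.hom.fV w).hom.hom (P.pt n)) :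
    ∀ q ∈ M, ∃ k ∈ 𝒢.branchSubgroup b₁ w hb₁, ((D.cover h𝒢 n).SV w).obj.ρ k
        ((q.hom.fV w).hom.hom (((σa * σ⁻¹ * σ').hom.fV w).hom.hom (P.pt n))) =
          ((σa * σ⁻¹ * σ').hom.fV w).hom.hom (P.pt n) := by
  classical
  set Z : Subgroup (D.Gal h𝒢 n) := (𝒢.branchSubgroup b₀ w hb₀).map ((D.proj h𝒢 n).comp P.decompHom)
    with hZ
  set M₁ : Subgroup (D.Gal h𝒢 n) := M.map (MulAut.conj σa⁻¹).toMonoidHom with hM₁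
  set M₂ : Subgroup (D.Gal h𝒢 n) := M.map (MulAut.conj σ⁻¹).toMonoidHom with hM₂
  have hM₁Z : M₁ ≤ Z := by
    rintro _ ⟨q, hq, rfl⟩
    have h := (P.exists_branchSubgroup_ρ_apply_eq_translate_iff n b₀ hb₀ q σa).mp (hα q hq)
    rw [P.exists_branchSubgroup_ρ_apply_eq_iff] at h
    have e : (MulAut.conj σa⁻¹).toMonoidHom q = σa⁻¹ * q * σa := by simp
    rw [e, hZ]
    exact h
  have hM₂Z : M₂ ≤ Z := by
    rintro _ ⟨q, hq, rfl⟩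
    have h := (P.exists_branchSubgroup_ρ_apply_eq_translate_iff n b₀ hb₀ q σ).mp (hβ q hq)
    rw [P.exists_branchSubgroup_ρ_apply_eq_iff] at h
    have e : (MulAut.conj σ⁻¹).toMonoidHom q = σ⁻¹ * q * σ := by simp
    rw [e, hZ]
    exact h
  -- the saturation step: `M₁ ≤ M₂`
  have hMM : M₁ ≤ M₂ := by
    rintro _ ⟨q, hq, rfl⟩
    have e₁ : (MulAut.conj σa⁻¹).toMonoidHom q = σa⁻¹ * q * σa := by simp
    have e₂ : (MulAut.conj σ⁻¹).toMonoidHom q = σ⁻¹ * q * σ := by simp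
    have hx : σa⁻¹ * q * σa ∈ Z := e₁ ▸ hM₁Z ⟨q, hq, rfl⟩
    have hy : σ⁻¹ * q * σ ∈ Z := e₂ ▸ hM₂Z ⟨q, hq, rfl⟩
    -- `z := (σ⁻¹ q σ)⁻¹ (σa⁻¹ q σa) ∈ Z` dies at level `j`
    have hzZ : (σ⁻¹ * q * σ)⁻¹ * (σa⁻¹ * q * σa) ∈ Z := Z.mul_mem (Z.inv_mem hy) hx
    have hz1 : D.mapLE h𝒢 hjn ((σ⁻¹ * q * σ)⁻¹ * (σa⁻¹ * q * σa)) = 1 := by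
      simp only [map_mul, map_inv, hlev]
      group
    have hzM : σ * ((σ⁻¹ * q * σ)⁻¹ * (σa⁻¹ * q * σa)) * σ⁻¹ ∈ M := hsat _ hzZ hz1
    refine ⟨q * (σ * ((σ⁻¹ * q * σ)⁻¹ * (σa⁻¹ * q * σa)) * σ⁻¹), M.mul_mem hq hzM, ?_⟩
    rw [e₁]
    have e₃ : (MulAut.conj σ⁻¹).toMonoidHom (q * (σ * ((σ⁻¹ * q * σ)⁻¹ * (σa⁻¹ * q * σa)) * σ⁻¹)) =
        σ⁻¹ * (q * (σ * ((σ⁻¹ * q * σ)⁻¹ * (σa⁻¹ * q * σa)) * σ⁻¹)) * σ := by simp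
    rw [e₃]
    group
  intro q hq
  have hq₁ : (MulAut.conj σa⁻¹).toMonoidHom q ∈ M₁ := ⟨q, hq, rfl⟩
  obtain ⟨q', hq', hqq'⟩ := hMM hq₁
  have hq_eq : q = σa * (σ⁻¹ * q' * σ) * σa⁻¹ := by
    simp only [MulEquiv.coe_toMonoidHom, MulAut.conj_apply, inv_inv] at hqq'
    rw [hqq']; group
  have hconj : (σa * σ⁻¹ * σ')⁻¹ * q * (σa * σ⁻¹ * σ') = σ'⁻¹ * q' * σ' := by
    rw [hq_eq]; group
  rw [P.exists_branchSubgroup_ρ_apply_eq_translate_iff, hconj,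
    ← P.exists_branchSubgroup_ρ_apply_eq_translate_iff]
  exact hβ' q' hq'

end PointSeq

/-! ### LOCAL TRANSPORT preserving images, tree form, arbitrary edge group -/

/-- **Image-preserving local transport of fixed branches, ARBITRARY edge group, under saturation at the
source branch.**  Let `j ≤ n`, let `v_a`, `v` be vertices of `𝔾̃_n` over the base vertex `w` (over which
a compatible point sequence `P₀` is given), let a subgroup `C` of `π₁^temp(𝒢)` fix (at level `n`) the edge
of a branch `α` at `v_a` over the base branch `b₀`, and the edges of two branches `β`, `β'` at `v` over `b₀`
and over `b₁`, suppose `α` and `β` have THE SAME IMAGE in `𝔾̃_j`, and suppose `β` SATURATED for `C`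
relative to level `j`: every element of `Gal(𝒢_{∞,n}/𝒢)` that fixes the edge of `β` and is trivial in
`Gal(𝒢_{∞,j}/𝒢)` lies in `ρ_n(C)`.  Then `C` fixes the edge of some branch `α'` at `v_a` over `b₁` WHOSE
IMAGE IN `𝔾̃_j` IS THAT OF `β'`.  (abc-iut-f-172's (A⁺) verbatim, with its cyclic step replaced by
`PointSeq.forall_exists_branchSubgroup_ρ_apply_eq_transport_of_saturated`.)
[cite: MochizukiSemiAnbd2006, Thm 3.7(iii) p.41] -/
theorem exists_fixed_branch_transport_sameImage_of_saturated (D : GaloisLevelData 𝒢)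
    (h𝒢 : 𝒢.IsCountable) {j n : ℕ} (hjn : j ≤ n)
    (C : Subgroup (D.temperedPi h𝒢)) {w : 𝒢.graph.Vertex} (P₀ : D.PointSeq h𝒢 w)
    {b₀ b₁ : 𝒢.graph.Branch} (hb₀ : 𝒢.graph.abuts b₀ = some w) (hb₁ : 𝒢.graph.abuts b₁ = some w)
    {va v : (D.tree n).Vertex} (hva : (D.treeProj n).vertexMap va = w)
    (hv : (D.treeProj n).vertexMap v = w)
    (α β β' : (D.tree n).Branch) (hα : (D.tree n).abuts α = some va)
    (hαb : (D.treeProj n).branchMap α = b₀) (hβ : (D.tree n).abuts β = some v)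
    (hβb : (D.treeProj n).branchMap β = b₀) (hβ' : (D.tree n).abuts β' = some v)
    (hβ'b : (D.treeProj n).branchMap β' = b₁)
    (himg : (D.treeTrans hjn).branchMap α = (D.treeTrans hjn).branchMap β)
    (hsat : ∀ q : D.Gal h𝒢 n, D.mapLE h𝒢 hjn q = 1 →
      (D.galTreeAct h𝒢 n q).hom.edgeMap ((D.tree n).edgeOf β) = (D.tree n).edgeOf β →
        q ∈ C.map (D.proj h𝒢 n))
    (hfixα : ∀ g ∈ C, (D.treeAct h𝒢 n g).hom.edgeMap ((D.tree n).edgeOf α) = (D.tree n).edgeOf α)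
    (hfixβ : ∀ g ∈ C, (D.treeAct h𝒢 n g).hom.edgeMap ((D.tree n).edgeOf β) = (D.tree n).edgeOf β)
    (hfixβ' : ∀ g ∈ C, (D.treeAct h𝒢 n g).hom.edgeMap ((D.tree n).edgeOf β') = (D.tree n).edgeOf β') :
    ∃ α' : (D.tree n).Branch, (D.tree n).abuts α' = some va ∧ (D.treeProj n).branchMap α' = b₁ ∧
      (D.treeTrans hjn).branchMap α' = (D.treeTrans hjn).branchMap β' ∧
      ∀ g ∈ C, (D.treeAct h𝒢 n g).hom.edgeMap ((D.tree n).edgeOf α') = (D.tree n).edgeOf α' := by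
  classical
  obtain ⟨P, hPv⟩ : ∃ P : D.PointSeq h𝒢 w, P.vertex n = v := P₀.exists_pointSeq_vertex_eq_of_treeProj n v hv
  -- cover coordinates of the three branches
  obtain ⟨σa, hαeq, hvaeq⟩ := P.exists_gal_eq_treeIso_brOf n b₀ hb₀ α hαb hα hva
  obtain ⟨σ, hβeq, hvσ⟩ := P.exists_gal_eq_treeIso_brOf n b₀ hb₀ β hβb hβ hv
  obtain ⟨σ', hβ'eq, hvσ'⟩ := P.exists_gal_eq_treeIso_brOf n b₁ hb₁ β' hβ'b hβ' hv
  -- notation for points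
  set pt := P.pt n with hpt
  -- the images at level `j` agree: `brOf b₀ (σ̄a · pt_j) = brOf b₀ (σ̄ · pt_j)`
  have himg' : (D.cover h𝒢 j).brOf b₀ hb₀ (((D.mapLE h𝒢 hjn σa).hom.fV w).hom.hom (P.pt j)) =
      (D.cover h𝒢 j).brOf b₀ hb₀ (((D.mapLE h𝒢 hjn σ).hom.fV w).hom.hom (P.pt j)) := by
    apply D.treeIso_hom_branchMap_injective h𝒢 j
    rw [← P.treeTrans_branchMap_brOf_gal_pt b₀ hb₀ hjn σa, ← P.treeTrans_branchMap_brOf_gal_pt b₀ hb₀ hjn σ,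
      ← hαeq, ← hβeq, himg]
  obtain ⟨k, hk, hkρ⟩ := ((D.cover h𝒢 j).brOf_eq_brOf_iff b₀ hb₀ _ _).mp himg'
  -- the adjusted representative `σa'' := σa · σ_n^{k⁻¹}` of `α`, with image `σ̄` at level `j`
  set σa'' : D.Gal h𝒢 n := σa * P.gal n k⁻¹ with hσa''
  have hσa''pt : (σa''.hom.fV w).hom.hom pt = ((D.cover h𝒢 n).SV w).obj.ρ k ((σa.hom.fV w).hom.hom pt) := by
    rw [hσa'', PointSeq.mul_fV_apply, P.gal_apply, inv_inv, CovHom.fV_ρ]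
  have hmapLE : D.mapLE h𝒢 hjn σa'' = D.mapLE h𝒢 hjn σ := by
    rw [hσa'', map_mul, P.mapLE_gal hjn]
    -- both sides agree on `pt_j`
    have hpt' : (((D.mapLE h𝒢 hjn σa * P.gal j k⁻¹).hom.fV w).hom.hom (P.pt j)) =
        ((D.mapLE h𝒢 hjn σ).hom.fV w).hom.hom (P.pt j) := by
      rw [PointSeq.mul_fV_apply, P.gal_apply, inv_inv, CovHom.fV_ρ, hkρ]
    have h1 : (D.mapLE h𝒢 hjn σ)⁻¹ * (D.mapLE h𝒢 hjn σa * P.gal j k⁻¹) = 1 := by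
      apply P.eq_one_of_fV_pt_eq j
      rw [PointSeq.mul_fV_apply, hpt', PointSeq.inv_fV_apply]
    rw [inv_mul_eq_one] at h1
    exact h1.symm
  -- `α` in the adjusted coordinates
  have hαeq'' : α = (D.treeIso h𝒢 n).hom.branchMap
      ((D.cover h𝒢 n).brOf b₀ hb₀ ((σa''.hom.fV w).hom.hom pt)) := by
    rw [hαeq, hσa''pt]
    congr 1
    exact ((D.cover h𝒢 n).brOf_eq_brOf_iff b₀ hb₀ _ _).mpr ⟨k, hk, rfl⟩
  have horb'' : (Quot.mk (D.cover h𝒢 n).VRel ⟨w, (σa''.hom.fV w).hom.hom pt⟩ : (D.cover h𝒢 n).OVertex) =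
      Quot.mk (D.cover h𝒢 n).VRel ⟨w, (σa.hom.fV w).hom.hom pt⟩ := by
    rw [hσa''pt]
    exact (Quot.sound (CovObj.VRel.mk (S := D.cover h𝒢 n) w k _)).symm
  -- point forms of the three fixedness hypotheses
  have hMα : ∀ q ∈ C.map (D.proj h𝒢 n), ∃ k' ∈ 𝒢.branchSubgroup b₀ w hb₀, ((D.cover h𝒢 n).SV w).obj.ρ k'
      ((q.hom.fV w).hom.hom ((σa''.hom.fV w).hom.hom pt)) = (σa''.hom.fV w).hom.hom pt :=
    P.forall_exists_branchSubgroup_ρ_apply_eq_of_edgeMap_eq n b₀ hb₀ σa'' C (by rw [← hpt, ← hαeq'']; exact hfixα)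
  have hMβ : ∀ q ∈ C.map (D.proj h𝒢 n), ∃ k' ∈ 𝒢.branchSubgroup b₀ w hb₀, ((D.cover h𝒢 n).SV w).obj.ρ k'
      ((q.hom.fV w).hom.hom ((σ.hom.fV w).hom.hom pt)) = (σ.hom.fV w).hom.hom pt :=
    P.forall_exists_branchSubgroup_ρ_apply_eq_of_edgeMap_eq n b₀ hb₀ σ C (by rw [← hpt, ← hβeq]; exact hfixβ)
  have hMβ' : ∀ q ∈ C.map (D.proj h𝒢 n), ∃ k' ∈ 𝒢.branchSubgroup b₁ w hb₁, ((D.cover h𝒢 n).SV w).obj.ρ k'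
      ((q.hom.fV w).hom.hom ((σ'.hom.fV w).hom.hom pt)) = (σ'.hom.fV w).hom.hom pt :=
    P.forall_exists_branchSubgroup_ρ_apply_eq_of_edgeMap_eq n b₁ hb₁ σ' C (by rw [← hpt, ← hβ'eq]; exact hfixβ')
  -- the saturation hypothesis in point form at `σ`: elements `σ σ_n^k σ⁻¹` (`k ∈ Π_{b₀}`) fix the edge of `β`
  have hsat' : ∀ z ∈ (𝒢.branchSubgroup b₀ w hb₀).map ((D.proj h𝒢 n).comp P.decompHom),
      D.mapLE h𝒢 hjn z = 1 → σ * z * σ⁻¹ ∈ C.map (D.proj h𝒢 n) := by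
    rintro _ ⟨k', hk', rfl⟩ hz1
    have egal : ((D.proj h𝒢 n).comp P.decompHom) k' = P.gal n k' := rfl
    apply hsat
    · rw [map_mul, map_mul, hz1, mul_one, map_inv, mul_inv_cancel]
    · -- the point computation: `k' · (σ σ_n^{k'} σ⁻¹)(σ·pt) = σ·pt`
      have hptfix : ((D.cover h𝒢 n).SV w).obj.ρ k'
          (((σ * ((D.proj h𝒢 n).comp P.decompHom) k' * σ⁻¹).hom.fV w).hom.hom ((σ.hom.fV w).hom.hom pt)) =
            (σ.hom.fV w).hom.hom pt := by
        rw [egal, PointSeq.mul_fV_apply, PointSeq.mul_fV_apply, PointSeq.inv_fV_apply, P.gal_apply,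
          CovHom.fV_ρ, ← ρ_mul_apply, mul_inv_cancel, ρ_one_apply]
      have hbr : (CovObj.orbitGraphMap (σ * ((D.proj h𝒢 n).comp P.decompHom) k' * σ⁻¹).hom).branchMap
          ((D.cover h𝒢 n).brOf b₀ hb₀ ((σ.hom.fV w).hom.hom pt)) =
            (D.cover h𝒢 n).brOf b₀ hb₀ ((σ.hom.fV w).hom.hom pt) := by
        rw [(D.cover h𝒢 n).branchMap_brOf b₀ hb₀, (D.cover h𝒢 n).brOf_eq_brOf_iff b₀ hb₀]
        exact ⟨k', hk', hptfix⟩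
      have hbr' : (D.galTreeAct h𝒢 n (σ * ((D.proj h𝒢 n).comp P.decompHom) k' * σ⁻¹)).hom.branchMap β = β := by
        rw [hβeq, D.galTreeAct_branchMap_treeIso h𝒢, hbr]
      rw [← (D.galTreeAct h𝒢 n _).hom.edgeOf_branchMap, hbr']
  -- the one-level transport, point form (saturated)
  have htr := P.forall_exists_branchSubgroup_ρ_apply_eq_transport_of_saturated n hjn hb₀ hb₁
    (C.map (D.proj h𝒢 n)) σa'' σ σ' hmapLE hsat' hMα hMβ hMβ'
  set z := ((σa'' * σ⁻¹ * σ').hom.fV w).hom.hom pt with hz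
  -- `σ · pt` and `σ' · pt` both lie in the orbit `v`
  have hσσ' : (Quot.mk (D.cover h𝒢 n).VRel ⟨w, (σ.hom.fV w).hom.hom pt⟩ : (D.cover h𝒢 n).OVertex) =
      Quot.mk (D.cover h𝒢 n).VRel ⟨w, (σ'.hom.fV w).hom.hom pt⟩ := by
    have h1 := hvσ.symm.trans hvσ'
    exact D.treeIso_hom_vertexMap_injective h𝒢 n h1
  refine ⟨(D.treeIso h𝒢 n).hom.branchMap ((D.cover h𝒢 n).brOf b₁ hb₁ z), ?_, ?_, ?_, ?_⟩
  · -- abuts `v_a`: the orbit of `z` is that of `σa'' · pt`, i.e. of `σa · pt`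
    have horb : (Quot.mk (D.cover h𝒢 n).VRel ⟨w, z⟩ : (D.cover h𝒢 n).OVertex) =
        Quot.mk (D.cover h𝒢 n).VRel ⟨w, (σa.hom.fV w).hom.hom pt⟩ := by
      rw [hz, P.mk_mul_inv_mul_fV_eq n σa'' σ σ' hσσ', horb'']
    have h := (D.treeIso h𝒢 n).hom.abuts_branchMap _ _ ((D.cover h𝒢 n).abuts_brOf b₁ hb₁ z)
    rw [h, horb, ← hvaeq]
  · rw [D.treeProj_branchMap_treeIso h𝒢]
    rfl
  · -- same image as `β'` at level `j`
    rw [hz, hβ'eq, P.treeTrans_branchMap_brOf_gal_pt b₁ hb₁ hjn, P.treeTrans_branchMap_brOf_gal_pt b₁ hb₁ hjn,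
      map_mul, map_mul, map_inv, hmapLE, mul_inv_cancel, one_mul]
  · intro g hg
    have hq : D.proj h𝒢 n g ∈ C.map (D.proj h𝒢 n) := ⟨g, hg, rfl⟩
    obtain ⟨k', hk', hkz⟩ := htr _ hq
    have hbr : (CovObj.orbitGraphMap (D.proj h𝒢 n g).hom).branchMap ((D.cover h𝒢 n).brOf b₁ hb₁ z) =
        (D.cover h𝒢 n).brOf b₁ hb₁ z := by
      rw [(D.cover h𝒢 n).branchMap_brOf b₁ hb₁, (D.cover h𝒢 n).brOf_eq_brOf_iff b₁ hb₁]
      exact ⟨k', hk', hkz⟩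
    have hbr' : (D.treeAct h𝒢 n g).hom.branchMap
        ((D.treeIso h𝒢 n).hom.branchMap ((D.cover h𝒢 n).brOf b₁ hb₁ z)) =
        (D.treeIso h𝒢 n).hom.branchMap ((D.cover h𝒢 n).brOf b₁ hb₁ z) := by
      rw [D.treeAct_apply, D.galTreeAct_branchMap_treeIso h𝒢, hbr]
    rw [← (D.treeAct h𝒢 n g).hom.edgeOf_branchMap, hbr']

end GaloisLevelData

end ProfiniteSemiGraph

end Literature.AnabelianGeometry.SemiGraphs
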